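import Summits.BirchSwinnertonDyer.BirchSwinnertonDyer.Theorems.UniversalToricDescentThinCombFibredSupply
import Summits.BirchSwinnertonDyer.BirchSwinnertonDyer.Theorems.UniversalToricDescentThinCombReflectionTransfer
import Summits.BirchSwinnertonDyer.BirchSwinnertonDyer.Theorems.UniversalToricDescentThinCombFrameInvolution
import Summits.BirchSwinnertonDyer.BirchSwinnertonDyer.Theorems.UniversalToricDescentThinCombGradingRenormalisationFirst
import Summits.BirchSwinnertonDyer.BirchSwinnertonDyer.Theorems.UniversalToricDescentThinCombFrameReflection
import HarnessLib

/-!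
# UNIQUENESS OF ♯♯-FRAMES: a ♯♯-frame is determined by its constants `(C, X, Y)`, and frames whose constants differ by units of `ℤ_p`
# are ASSOCIATED (helper on the rational wall `RationalSplitIMCInclusionAtThree`, stmt-BirchSwinnertonDyer-24207, line `ratwall_thin_comb` v10;
# cell `pub/bsd-wall`, LEAD `cruxlead-24207` g36; `--supports stmt-BirchSwinnertonDyer-24207`; nothing is closed; BSD is not proved)

WHY THIS FILE. The line's first stub asks for a ♯♯-frame `L₂ ∈ R₀⟦T₁⟧⟦T₂⟧` of the toric two-variable `p`-adic `L`-function of `f_E`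
(`IsToricTwoVarLFunctionUpTo₂ C X Y …`: prescribed values at the points of all everywhere-unramified characters of type `(a, −b)`, `a, b ≥ 1`, through
the pair). In a `𝔭`-adapted frame of the `ℤ_p²`-tower of an imaginary quadratic `K` (`κ₁` unramified outside `𝔭`) these points contain an INNER-FIBRED
infinite set (`…ThinComb.FibredSupply.fibredSupply`, modulo Jacquet's cone fact for the continuations), on which a bounded two-variable series is
determined by its values (`…ThinComb.ReflectionTransfer.unr_eq_of_infinite_hasValueAt₂_eq_innerFibred`). Hence:

* §1 **`eq_of_isToricTwoVarLFunctionUpTo₂`** — two ♯♯-frames with the SAME constants `(C, X, Y)` (same `ι′`, primes, pair, `f`, `Ω_K`) are EQUAL: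
  the predicate PINS `L₂` (the tree's form of Hao–Loeffler's remark «this p-adic L-function is necessarily unique, due to the density of …
  points»; no vacuity hides in the ∃ of the stub beyond the existence itself).
* §2 **`exists_unit_mul_eq_of_isToricTwoVarLFunctionUpTo₂_of_units`** — if `L` is a `(C, X, Y)`-frame and `L′` a `(C, X·u₁, Y·u₂)`-frame with
  `u₁, u₂ ∈ ℤ_pˣ`, then `L′ = G·L` for the group-like UNIT `G` of `…ThinComb.GradingRenormalisation` (both gradings are free up to `ℤ_pˣ`), in
  particular `Associated L′ L` (`associated_of_isToricTwoVarLFunctionUpTo₂_of_units`): the frame is unique UP TO A GROUP-LIKE UNIT once its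
  constants are fixed up to `ℤ_pˣ × ℤ_pˣ` — the exact sense in which (N♭) «up to `ℤ₃ˣ`» loses nothing for the line's ideal-theoretic consumers.
* §3 **`associated_frameSubst_of_ratio_unit`** (p = 3) — THE SYMMETRY CLAUSE FROM THE RATIO ALONE: if `L₂` is a `(C, X, Y)`-frame whose grading ratio
  `λ₀ = X·κ̂/Y` is a unit of `ℤ₃` (`X·κ̂ = Y·u`), then `φ_{A_τ} L₂ ∼ L₂` — `φ_{A_τ}L₂` is a `(C, X·u⁻¹, Y·u)`-frame (`…ThinComb.FrameReflection`), hence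
  associated with `L₂` by §2. This is clause (ii) of the line's v8.2 stub 1 for EVERY frame with `λ₀ ∈ ℤ₃ˣ`, conceptually (V85 proves the case
  `Y = X·κ̂·u` through the supply argument of V83/V84).

HONEST SCOPE: statements about the interpolation predicate, conditional on the named print fact `jacquet1972_functionalEquation_rankinSelbergHecke_cone`
(continuations on the cone, used by the supply); nothing here is evidence that a frame exists at an additive split `3`; BSD is proved for no curve;
24207 / 20395 / 20186 / 32493 OPEN.

References: [cite: HaoLoeffler2025, Thm. 3.5 and the remark after it (uniqueness by density; arXiv:2405.12611)] [cite: CastellaWan2023, §2.4 Thm. 2.11 (arXiv:1607.02019)]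
[cite: deShalit1987, II.4.17 (54)] [cite: Jacquet1972, §19 Cor. 19.15] [cite: SerreAbelianLadic1968, Ch. III §2.3]
-/

set_option linter.dupNamespace false
set_option autoImplicit false

noncomputable section

open scoped Classical MatrixGroups

namespace Summit.BirchSwinnertonDyer.BirchSwinnertonDyer.Theorems.UniversalToricDescentThinComb.FrameUniqueness

open NumberField IsDedekindDomain Field
open Literature.NumberTheory.EllipticCurves Literature.NumberTheory.GaloisRepresentations
open Summit.BirchSwinnertonDyer.Rank1Residual.X11b.Halves
open Summit.BirchSwinnertonDyer.BirchSwinnertonDyer.Theorems.UniversalToricDescentThinComb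

variable {p : ℕ} [Fact p.Prime] {K : Type} [Field K] [NumberField K]

/-! ### §1. A ♯♯-frame is determined by its constants -/

/-- **UNIQUENESS OF THE ♯♯-FRAME.** In a `𝔭`-adapted generator pair of the `ℤ_p²`-tower (`p ≠ 2` split in the imaginary quadratic `K`,
Heegner for `N`; `ι′` inducing `𝔭`; `κ₁` unramified outside `𝔭`) two ♯♯-frames of the toric two-variable function of `f = Dt.f` with the same
constants `(C, X, Y)` and period `Ω_K` are EQUAL series — values agree on the inner-fibred supply of interpolation points (`fibredSupply`), and a
bounded two-variable series vanishing there is zero (`unr_eq_of_infinite_hasValueAt₂_eq_innerFibred`). Conditional on Jacquet's cone fact (the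
supply's continuations). [cite: HaoLoeffler2025, Thm. 3.5, remark (arXiv:2405.12611)] [cite: deShalit1987, II.4.17 (54)] -/
theorem eq_of_isToricTwoVarLFunctionUpTo₂ (hJ : jacquet1972_functionalEquation_rankinSelbergHecke_cone) (hp2 : p ≠ 2)
    (hK : IsImaginaryQuadratic K) {N : ℕ} [NeZero N] (W : WeierstrassCurve ℚ)
    (Dt : Literature.NumberTheory.EllipticCurves.ModularForms.ModularParametrizationData W N)
    (hH : SatisfiesHeegnerHypothesis N K)
    {𝔭 : HeightOneSpectrum (𝓞 K)} (h3 : ((p : ℕ) : 𝓞 K) ∈ 𝔭.asIdeal)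
    {𝔭' : HeightOneSpectrum (𝓞 K)} (h3' : ((p : ℕ) : 𝓞 K) ∈ 𝔭'.asIdeal) (hne : 𝔭' ≠ 𝔭)
    (ι' : PadicAlgCl p ≃+* ℂ) (hι : ∀ (w : InfinitePlace K) (k : 𝓞 K), k ∈ 𝔭.asIdeal ↔ ‖ι'.symm (w.embedding (k : K))‖ < 1)
    {κ₁ κ₂ : ZpExtension K p} {γ₁ γ₂ : absoluteGaloisGroup K} (hpair : ZpExtension.IsTopGeneratorPair κ₁ κ₂ γ₁ γ₂)
    (hur₁ : ∀ v : HeightOneSpectrum (𝓞 K), v ≠ 𝔭 → ∀ 𝔓 ∈ v.primesAbove,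
      𝔓.inertia (absoluteGaloisGroup K) ≤ κ₁.kerSubgroup)
    {ΩK : ℂ} {C X Y : ℂ_[p]} {L L' : PowerSeries (UnrSeries p)}
    (hL : IsToricTwoVarLFunctionUpTo₂ C X Y ι' 𝔭 𝔭' κ₁ κ₂ γ₁ γ₂ Dt.f ΩK L)
    (hL' : IsToricTwoVarLFunctionUpTo₂ C X Y ι' 𝔭 𝔭' κ₁ κ₂ γ₁ γ₂ Dt.f ΩK L') : L = L' := by
  obtain ⟨c, hc⟩ := FrameInvolution.exists_not_mem_range_absGaloisRestrict_rat hK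
  obtain ⟨τ, hτ⟩ := FrameInvolution.exists_conjInv hK.1 c
  obtain ⟨ϖ, hϖ0, hϖ, D₂, hD₂, hD₂ϖ, hfib⟩ :=
    FibredSupply.fibredSupply hJ hp2 hK W Dt hH h3 h3' hne ι' hι hpair hur₁ hc hτ
  refine ReflectionTransfer.unr_eq_of_infinite_hasValueAt₂_eq_innerFibred hϖ0 hϖ hD₂ hD₂ϖ
    fun y hy ↦ (hfib y hy).mono fun x hx ↦ ⟨hx.1, ?_⟩
  obtain ⟨ψ, a, b, r, Lc, ha, hb, hinf, hunr, hr, hrκ, hLd, hLe, hx1, hy1⟩ := hx.2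
  have h1 := hL ψ a b ha hb hinf hunr r hr hrκ Lc hLd hLe
  have h2 := hL' ψ a b ha hb hinf hunr r hr hrκ Lc hLd hLe
  rw [hx1, hy1] at h1 h2
  exact ⟨_, h1, h2⟩

/-! ### §2. Frames whose constants differ by units of `ℤ_p` are associated -/

/-- The group-like element `(1+T₁)^{x₁}(1+T₂)^{x₂}` of `R₀⟦T₁⟧⟦T₂⟧` is a UNIT. [cite: NeukirchSchmidtWingberg2008, (5.3.5)] -/
theorem isUnit_groupLike (x₁ x₂ : ℤ_[p]) :
    IsUnit (PowerSeries.map (PowerSeries.C (R := unrIntegers p)) ((PowerSeries.binomialSeries ℤ_[p] x₁).map (toUnr p)) *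
      PowerSeries.C ((PowerSeries.binomialSeries ℤ_[p] x₂).map (toUnr p))) := by
  letI : Algebra ℤ_[p] (unrIntegers p) := (toUnr p).toAlgebra
  have hmap₁ := IwasawaAlgebra₂.map_binomialSeries (unrIntegers p) x₁
  have hmap₂ := IwasawaAlgebra₂.map_binomialSeries (unrIntegers p) x₂
  rw [RingHom.algebraMap_toAlgebra] at hmap₁ hmap₂
  have h : IsUnit (Literature.NumberTheory.IwasawaTheory.nestedPowerSeriesEquiv
      (PowerSeries.map (PowerSeries.C (R := unrIntegers p)) ((PowerSeries.binomialSeries ℤ_[p] x₁).map (toUnr p)) *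
        PowerSeries.C ((PowerSeries.binomialSeries ℤ_[p] x₂).map (toUnr p)))) := by
    rw [map_mul, hmap₁, hmap₂, IwasawaAlgebra₂.nestedPowerSeriesEquiv_onePlusT₁Pow, IwasawaAlgebra₂.nestedPowerSeriesEquiv_onePlusT₂Pow]
    exact (IwasawaAlgebra₂.isUnit_onePlusXPow _ 0 x₁).mul (IwasawaAlgebra₂.isUnit_onePlusXPow _ 1 x₂)
  simpa using h.map (Literature.NumberTheory.IwasawaTheory.nestedPowerSeriesEquiv (R := unrIntegers p)).symm

/-- **FRAMES WITH `ℤ_pˣ`-PROPORTIONAL CONSTANTS DIFFER BY A GROUP-LIKE UNIT.** In the setting of §1 (with `𝔭` of degree one): if `L` is a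
`(C, X, Y)`-frame and `L′` a `(C, X·u₁, Y·u₂)`-frame, `u₁, u₂ ∈ ℤ_pˣ`, then `L′ = G · L` for some unit `G` of `R₀⟦T₁⟧⟦T₂⟧` (the group-like
element rescaling both gradings, `…GradingRenormalisation.exists_isToricTwoVarLFunctionUpTo₂_rescale_both`, followed by §1).
[cite: HaoLoeffler2025, Thm. 3.5, remark (arXiv:2405.12611)] [cite: SerreAbelianLadic1968, Ch. III §2.3] -/
theorem exists_unit_mul_eq_of_isToricTwoVarLFunctionUpTo₂_of_units (hJ : jacquet1972_functionalEquation_rankinSelbergHecke_cone)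
    (hp2 : p ≠ 2) (hK : IsImaginaryQuadratic K) {N : ℕ} [NeZero N] (W : WeierstrassCurve ℚ)
    (Dt : Literature.NumberTheory.EllipticCurves.ModularForms.ModularParametrizationData W N)
    (hH : SatisfiesHeegnerHypothesis N K)
    {𝔭 : HeightOneSpectrum (𝓞 K)} (h3 : ((p : ℕ) : 𝓞 K) ∈ 𝔭.asIdeal)
    (he : 𝔭.asIdeal.ramificationIdx (𝓞 ℚ) = 1) (hf : 𝔭.asIdeal.inertiaDeg (𝓞 ℚ) = 1)
    {𝔭' : HeightOneSpectrum (𝓞 K)} (h3' : ((p : ℕ) : 𝓞 K) ∈ 𝔭'.asIdeal) (hne : 𝔭' ≠ 𝔭)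
    (ι' : PadicAlgCl p ≃+* ℂ) (hι : Summit.BirchSwinnertonDyer.BirchSwinnertonDyer.Theorems.SchneiderFree.BranchInducesPrime p ι' 𝔭)
    {κ₁ κ₂ : ZpExtension K p} {γ₁ γ₂ : absoluteGaloisGroup K} (hpair : ZpExtension.IsTopGeneratorPair κ₁ κ₂ γ₁ γ₂)
    (hur₁ : ∀ v : HeightOneSpectrum (𝓞 K), v ≠ 𝔭 → ∀ 𝔓 ∈ v.primesAbove,
      𝔓.inertia (absoluteGaloisGroup K) ≤ κ₁.kerSubgroup)
    {ΩK : ℂ} {C X Y : ℂ_[p]} {L L' : PowerSeries (UnrSeries p)} (u₁ u₂ : ℤ_[p]ˣ)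
    (hL : IsToricTwoVarLFunctionUpTo₂ C X Y ι' 𝔭 𝔭' κ₁ κ₂ γ₁ γ₂ Dt.f ΩK L)
    (hL' : IsToricTwoVarLFunctionUpTo₂ C (X * algebraMap ℚ_[p] ℂ_[p] ((u₁ : ℤ_[p]) : ℚ_[p]))
      (Y * algebraMap ℚ_[p] ℂ_[p] ((u₂ : ℤ_[p]) : ℚ_[p])) ι' 𝔭 𝔭' κ₁ κ₂ γ₁ γ₂ Dt.f ΩK L') :
    ∃ G : PowerSeries (UnrSeries p), IsUnit G ∧ L' = G * L := by
  -- the grading elements at `𝔭` (first grading) and at `𝔭′` (second grading)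
  obtain ⟨g₁, hg₁⟩ := GradingRenormalisation.exists_avatarValueAt_eq_unit_pow_fst ι' hK h3 he hf hι u₁
  obtain ⟨g₂, hg₂⟩ := GradingRenormalisation.exists_avatarValueAt_eq_unit_pow ι' hK h3 h3' hne hι u₂
  have hL₁ := GradingRenormalisation.isToricTwoVarLFunctionUpTo₂_groupLike_mul_fst hpair g₁ _
    (fun ψ a b _ _ hinf hunr r hr ↦ hg₁ ψ a b r hinf hunr hr) hL
  have hL₂ := GradingRenormalisation.isToricTwoVarLFunctionUpTo₂_groupLike_mul hpair g₂ _
    (fun ψ a b _ _ hinf hunr r hr ↦ hg₂ ψ a b r hinf hunr hr) hL₁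
  refine ⟨_, ?_, (eq_of_isToricTwoVarLFunctionUpTo₂ hJ hp2 hK W Dt hH h3 h3' hne ι' hι hpair hur₁ hL' hL₂).trans (mul_assoc _ _ _).symm⟩
  exact (isUnit_groupLike _ _).mul (isUnit_groupLike _ _)

/-- **Corollary: frames with `ℤ_pˣ`-proportional constants are ASSOCIATED** — the ♯♯-frame is unique up to a (group-like) unit once its
constants are fixed up to `ℤ_pˣ × ℤ_pˣ`; ideal-theoretic consumers (`Associated`, divisibility with `p`-power slack, characteristic-ideal
membership) do not see the difference. [cite: HaoLoeffler2025, Thm. 3.5, remark (arXiv:2405.12611)] -/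
theorem associated_of_isToricTwoVarLFunctionUpTo₂_of_units (hJ : jacquet1972_functionalEquation_rankinSelbergHecke_cone)
    (hp2 : p ≠ 2) (hK : IsImaginaryQuadratic K) {N : ℕ} [NeZero N] (W : WeierstrassCurve ℚ)
    (Dt : Literature.NumberTheory.EllipticCurves.ModularForms.ModularParametrizationData W N)
    (hH : SatisfiesHeegnerHypothesis N K)
    {𝔭 : HeightOneSpectrum (𝓞 K)} (h3 : ((p : ℕ) : 𝓞 K) ∈ 𝔭.asIdeal)
    (he : 𝔭.asIdeal.ramificationIdx (𝓞 ℚ) = 1) (hf : 𝔭.asIdeal.inertiaDeg (𝓞 ℚ) = 1)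
    {𝔭' : HeightOneSpectrum (𝓞 K)} (h3' : ((p : ℕ) : 𝓞 K) ∈ 𝔭'.asIdeal) (hne : 𝔭' ≠ 𝔭)
    (ι' : PadicAlgCl p ≃+* ℂ) (hι : Summit.BirchSwinnertonDyer.BirchSwinnertonDyer.Theorems.SchneiderFree.BranchInducesPrime p ι' 𝔭)
    {κ₁ κ₂ : ZpExtension K p} {γ₁ γ₂ : absoluteGaloisGroup K} (hpair : ZpExtension.IsTopGeneratorPair κ₁ κ₂ γ₁ γ₂)
    (hur₁ : ∀ v : HeightOneSpectrum (𝓞 K), v ≠ 𝔭 → ∀ 𝔓 ∈ v.primesAbove,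
      𝔓.inertia (absoluteGaloisGroup K) ≤ κ₁.kerSubgroup)
    {ΩK : ℂ} {C X Y : ℂ_[p]} {L L' : PowerSeries (UnrSeries p)} (u₁ u₂ : ℤ_[p]ˣ)
    (hL : IsToricTwoVarLFunctionUpTo₂ C X Y ι' 𝔭 𝔭' κ₁ κ₂ γ₁ γ₂ Dt.f ΩK L)
    (hL' : IsToricTwoVarLFunctionUpTo₂ C (X * algebraMap ℚ_[p] ℂ_[p] ((u₁ : ℤ_[p]) : ℚ_[p]))
      (Y * algebraMap ℚ_[p] ℂ_[p] ((u₂ : ℤ_[p]) : ℚ_[p])) ι' 𝔭 𝔭' κ₁ κ₂ γ₁ γ₂ Dt.f ΩK L') :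
    Associated L' L := by
  obtain ⟨G, hG, hGL⟩ :=
    exists_unit_mul_eq_of_isToricTwoVarLFunctionUpTo₂_of_units hJ hp2 hK W Dt hH h3 he hf h3' hne ι' hι hpair hur₁ u₁ u₂ hL hL'
  obtain ⟨G', rfl⟩ := hG
  exact ⟨G'⁻¹, by rw [hGL, mul_comm ((G' : PowerSeries (UnrSeries p))) L, mul_assoc, Units.mul_inv, mul_one]⟩

/-! ### §3. The symmetry clause from the grading ratio alone (`p = 3`) -/

/-- **`φ_{A_τ} L₂ ∼ L₂` WHENEVER THE GRADING RATIO `X·κ̂/Y` IS A UNIT OF `ℤ₃`.** In the stub's frame at `p = 3` (imaginary quadratic `K` Heegner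
for `N`, `3 = 𝔭𝔭′`, `𝔭` of degree one induced by `ι′`, `κ₁` unramified outside `𝔭`, `f = Dt.f`), for a complex conjugation `c`, a lift `τ` and its
frame matrix `A`: if `L₂` is a ♯♯-frame with constants `(C, X, Y)` and `X·κ̂ = Y·u` for some `u ∈ ℤ₃ˣ` (`κ̂ = ι′⁻¹(N·|d_K|/4)`), then
`Associated (φ_A L₂) L₂`. Conditional on Jacquet's cone fact. [cite: HaoLoeffler2025, §4 (arXiv:2405.12611)] [cite: Jacquet1972, §19 Thm. 19.14, Cor. 19.15]
[cite: BuyukbodukLei2017, Def. 3.8 (arXiv:1707.00557)] -/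
theorem associated_frameSubst_of_ratio_unit (hJ : jacquet1972_functionalEquation_rankinSelbergHecke_cone)
    (hK : IsImaginaryQuadratic K) {N : ℕ} [NeZero N] (W : WeierstrassCurve ℚ)
    (Dt : Literature.NumberTheory.EllipticCurves.ModularForms.ModularParametrizationData W N)
    (hH : SatisfiesHeegnerHypothesis N K)
    {𝔭 : HeightOneSpectrum (𝓞 K)} (h3 : ((3 : ℕ) : 𝓞 K) ∈ 𝔭.asIdeal)
    (he : 𝔭.asIdeal.ramificationIdx (𝓞 ℚ) = 1) (hf : 𝔭.asIdeal.inertiaDeg (𝓞 ℚ) = 1)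
    {𝔭' : HeightOneSpectrum (𝓞 K)} (h3' : ((3 : ℕ) : 𝓞 K) ∈ 𝔭'.asIdeal) (hne : 𝔭' ≠ 𝔭)
    (ι' : PadicAlgCl 3 ≃+* ℂ) (hι : Summit.BirchSwinnertonDyer.BirchSwinnertonDyer.Theorems.SchneiderFree.BranchInducesPrime 3 ι' 𝔭)
    {κ₁ κ₂ : ZpExtension K 3} {γ₁ γ₂ : absoluteGaloisGroup K} (hpair : ZpExtension.IsTopGeneratorPair κ₁ κ₂ γ₁ γ₂)
    (hur₁ : ∀ v : HeightOneSpectrum (𝓞 K), v ≠ 𝔭 → ∀ 𝔓 ∈ v.primesAbove,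
      𝔓.inertia (absoluteGaloisGroup K) ≤ κ₁.kerSubgroup)
    {c : absoluteGaloisGroup ℚ} (hc : c ∉ Set.range (absGaloisRestrict ℚ K))
    {τ : absoluteGaloisGroup K → absoluteGaloisGroup K}
    (hτ : ∀ σ, absGaloisRestrict ℚ K (τ σ) = c * (absGaloisRestrict ℚ K σ)⁻¹ * c⁻¹)
    (A : GL (Fin 2) ℤ_[3]) (hA : (A : Matrix (Fin 2) (Fin 2) ℤ_[3]) = IwasawaAlgebra₂.frameMatrixOf κ₁ κ₂ γ₁ γ₂ τ)
    {ΩK : ℂ} {C X Y : ℂ_[3]} {L₂ : PowerSeries (UnrSeries 3)} (u : ℤ_[3]ˣ)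
    (hXY : X * (((ι'.symm ((N : ℂ) * ((NumberField.discr K).natAbs : ℂ) / 4) : PadicAlgCl 3)) : ℂ_[3]) =
      Y * algebraMap ℚ_[3] ℂ_[3] ((u : ℤ_[3]) : ℚ_[3]))
    (hL : IsToricTwoVarLFunctionUpTo₂ C X Y ι' 𝔭 𝔭' κ₁ κ₂ γ₁ γ₂ Dt.f ΩK L₂) :
    letI : Algebra ℤ_[3] (unrIntegers 3) := (toUnr 3).toAlgebra
    Associated (IwasawaAlgebra₂.frameSubst (unrIntegers 3) A L₂) L₂ := by
  letI : Algebra ℤ_[3] (unrIntegers 3) := (toUnr 3).toAlgebra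
  have hrefl := FrameReflection.isToricTwoVarLFunctionUpTo₂_frameSubst_involution hJ hK Dt.f Dt.isNewformOf.1 hH h3 h3' hne ι'
    hpair hc hτ A hA hL
  -- `Y·κ̂⁻¹ = X·u⁻¹` and `X·κ̂ = Y·u`
  set κh : ℂ_[3] := (((ι'.symm ((N : ℂ) * ((NumberField.discr K).natAbs : ℂ) / 4) : PadicAlgCl 3)) : ℂ_[3]) with hκh
  have hu0 : algebraMap ℚ_[3] ℂ_[3] ((u : ℤ_[3]) : ℚ_[3]) ≠ 0 := by
    rw [map_ne_zero_iff _ (algebraMap ℚ_[3] ℂ_[3]).injective]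
    exact PadicInt.coe_ne_zero.mpr (Units.ne_zero u)
  have hκh0 : κh ≠ 0 := by
    have hκc0 : ((N : ℂ) * ((NumberField.discr K).natAbs : ℂ) / 4) ≠ 0 := by
      refine div_ne_zero (mul_ne_zero (by exact_mod_cast NeZero.ne N) ?_) (by norm_num)
      exact_mod_cast Int.natAbs_ne_zero.mpr (NumberField.discr_ne_zero K)
    rw [hκh, PadicComplex.coe_eq]
    exact (map_ne_zero_iff _ (algebraMap (PadicAlgCl 3) ℂ_[3]).injective).mpr ((map_ne_zero_iff _ ι'.symm.injective).mpr hκc0)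
  have h1 : Y * κh⁻¹ = X * algebraMap ℚ_[3] ℂ_[3] (((u⁻¹ : ℤ_[3]ˣ) : ℤ_[3]) : ℚ_[3]) := by
    have hinvQ : (((u⁻¹ : ℤ_[3]ˣ) : ℤ_[3]) : ℚ_[3]) = (((u : ℤ_[3]) : ℚ_[3]))⁻¹ :=
      eq_inv_of_mul_eq_one_left (by rw [← PadicInt.coe_mul, Units.inv_mul, PadicInt.coe_one])
    rw [hinvQ, map_inv₀, eq_mul_inv_iff_mul_eq₀ hu0, mul_right_comm, ← hXY, mul_assoc, mul_inv_cancel₀ hκh0, mul_one]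
  have h2 : X * κh = Y * algebraMap ℚ_[3] ℂ_[3] ((u : ℤ_[3]) : ℚ_[3]) := hXY
  rw [h1, h2] at hrefl
  exact associated_of_isToricTwoVarLFunctionUpTo₂_of_units hJ (by norm_num) hK W Dt hH h3 he hf h3' hne ι' hι hpair hur₁ u⁻¹ u hL hrefl

end Summit.BirchSwinnertonDyer.BirchSwinnertonDyer.Theorems.UniversalToricDescentThinComb.FrameUniqueness

end
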